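import Literature.Analysis.FluidPDE.PineauVicolRSSHolds
import HarnessLib

/-!
# Crux `NoTypeIBlowup` (stmt-NavierStokesRegularity-1217),
  line `killing-twisted-bernoulli-solitons`: stub `rssStratum_transl_of_screw`
  (screw-symmetric profile whose ansatz field coincides with its screw-conjugate ⇒ invariant under
  all translations along the axis)

Helical stratum of Pineau–Vicol, Conjecture 1.1 (arXiv:2607.09619): a Type-I rotating
self-similar profile `U` that is screw-symmetric about the axis, `U (R_ψ y + h e₃) = R_ψ (U y)` with
pitch `h ≠ 0` (`e₃ = EuclideanSpace.single 2 1`, `R_θ = rotZ θ`), produces the rotated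
self-similar ansatz field `pvAnsatz α U` ((1.7): `u(x,t) = (−t)^{−1/2} R(αs) U(R(−αs) x/√(−t))`,
`s = −log(−t)`), which by rigid-motion covariance and forward uniqueness coincides on
`t ∈ (−1, −1/2)` with its screw-conjugate `x ↦ R_ψ u(R_{−ψ}(x − h e₃), t)`. This file is the purely
algebraic step: that coincidence forces `U` to be invariant under EVERY translation along the axis.

* `RssStratumScrew.screw_of_coincide` — write `λ = (−t)^{−1/2} ∈ (1, √2)`, `θ = α s` and
  `Φ = R_θ ∘ U ∘ R_{−θ}`; evaluating the coincidence at `x = λ⁻¹ (R_ψ w + λ h e₃)` and cancelling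
  the common factor `λ` shows that `Φ` is screw-symmetric with angle `ψ` and pitch `λ h`.
* `RssStratumScrew.screw_conj` — `Φ` is also screw-symmetric with angle `ψ` and the original
  pitch `h` (rotations about the axis commute and fix `e₃`).
* `RssStratumScrew.transl_of_two_screws`, `RssStratumScrew.transl_of_conj` — two screw
  symmetries with the same angle and pitches `h`, `λ h` give the translation symmetry by
  `(1 − λ) h` of `Φ`, hence of `U`.
* `RssStratumScrew.transl_zero/add/neg/nat_mul/of_abs_lt/all` — the axial translation lengths
  leaving `U` invariant form an additive subgroup of `ℝ`; it contains the interval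
  `(−h) · (0, √2 − 1)` (`RssStratumScrew.transl_interval`, `λ = 1 + σ`, `t = −(1 + σ)^{−2}`), hence
  a neighbourhood of `0` (differences), hence all of `ℝ` (Archimedes).
* `rssStratum_transl_of_screw` — the registered statement.

Lands `--supports stmt-NavierStokesRegularity-1217`.
-/

noncomputable section

set_option linter.dupNamespace false

namespace Summit.NavierStokesRegularity.NavierStokesRegularity.Theorems

open Literature.Analysis.FluidPDE Set

namespace RssStratumScrew

/-! ### Rotations about the axis: linearity, the fixed axial direction -/

/-- The rotations fix the axial direction: `R_θ e₃ = e₃`. [folklore] -/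
private theorem rotZ_e (θ : ℝ) :
    rotZ θ (EuclideanSpace.single 2 (1 : ℝ)) = EuclideanSpace.single 2 (1 : ℝ) := by
  ext i
  fin_cases i <;> simp [rotZ]

/-- `R_θ` is additive. [folklore] -/
private theorem rotZ_add_vec (θ : ℝ) (a b : EuclideanSpace ℝ (Fin 3)) :
    rotZ θ (a + b) = rotZ θ a + rotZ θ b :=
  (rotZL θ).map_add a b

/-- `R_θ` commutes with scalars. [folklore] -/
private theorem rotZ_smul_vec (θ c : ℝ) (a : EuclideanSpace ℝ (Fin 3)) :
    rotZ θ (c • a) = c • rotZ θ a :=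
  (rotZL θ).map_smul c a

/-- `R_θ (a + c e₃) = R_θ a + c e₃`. [folklore] -/
private theorem rotZ_add_smul_e (θ : ℝ) (a : EuclideanSpace ℝ (Fin 3)) (c : ℝ) :
    rotZ θ (a + c • EuclideanSpace.single 2 (1 : ℝ)) =
      rotZ θ a + c • EuclideanSpace.single 2 (1 : ℝ) := by
  rw [rotZ_add_vec, rotZ_smul_vec, rotZ_e]

/-- `R_{−θ} (R_θ x) = x`. [folklore] -/
private theorem rotZ_neg_rotZ (θ : ℝ) (x : EuclideanSpace ℝ (Fin 3)) :
    rotZ (-θ) (rotZ θ x) = x := by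
  rw [← rotZ_add, neg_add_cancel, rotZ_zero]

/-- `R_θ (R_{−θ} x) = x`. [folklore] -/
private theorem rotZ_rotZ_neg (θ : ℝ) (x : EuclideanSpace ℝ (Fin 3)) :
    rotZ θ (rotZ (-θ) x) = x := by
  rw [← rotZ_add, add_neg_cancel, rotZ_zero]

/-- Rotations about the axis commute. [folklore] -/
private theorem rotZ_comm (θ φ : ℝ) (x : EuclideanSpace ℝ (Fin 3)) :
    rotZ θ (rotZ φ x) = rotZ φ (rotZ θ x) := by
  rw [← rotZ_add, add_comm, rotZ_add]

/-! ### The axial translation lengths leaving `U` invariant form a subgroup of `ℝ` -/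

/-- The length `0` is a translation symmetry of every field. [folklore] -/
theorem transl_zero (U : EuclideanSpace ℝ (Fin 3) → EuclideanSpace ℝ (Fin 3))
    (y : EuclideanSpace ℝ (Fin 3)) : U (y + (0 : ℝ) • EuclideanSpace.single 2 (1 : ℝ)) = U y := by
  rw [zero_smul, add_zero]

/-- Translation symmetries are closed under addition. [folklore] -/
theorem transl_add {U : EuclideanSpace ℝ (Fin 3) → EuclideanSpace ℝ (Fin 3)} {c d : ℝ}
    (hc : ∀ y, U (y + c • EuclideanSpace.single 2 (1 : ℝ)) = U y)
    (hd : ∀ y, U (y + d • EuclideanSpace.single 2 (1 : ℝ)) = U y)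
    (y : EuclideanSpace ℝ (Fin 3)) : U (y + (c + d) • EuclideanSpace.single 2 (1 : ℝ)) = U y := by
  rw [add_smul, ← add_assoc, hd, hc]

/-- Translation symmetries are closed under negation. [folklore] -/
theorem transl_neg {U : EuclideanSpace ℝ (Fin 3) → EuclideanSpace ℝ (Fin 3)} {c : ℝ}
    (hc : ∀ y, U (y + c • EuclideanSpace.single 2 (1 : ℝ)) = U y)
    (y : EuclideanSpace ℝ (Fin 3)) : U (y + (-c) • EuclideanSpace.single 2 (1 : ℝ)) = U y := by
  have h := hc (y + (-c) • EuclideanSpace.single 2 (1 : ℝ))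
  rw [add_assoc, ← add_smul, neg_add_cancel, zero_smul, add_zero] at h
  exact h.symm

/-- Translation symmetries are closed under natural multiples. [folklore] -/
theorem transl_nat_mul {U : EuclideanSpace ℝ (Fin 3) → EuclideanSpace ℝ (Fin 3)} {c : ℝ}
    (hc : ∀ y, U (y + c • EuclideanSpace.single 2 (1 : ℝ)) = U y) (n : ℕ)
    (y : EuclideanSpace ℝ (Fin 3)) :
    U (y + ((n : ℝ) * c) • EuclideanSpace.single 2 (1 : ℝ)) = U y := by
  induction n generalizing y with
  | zero =>
    rw [Nat.cast_zero, zero_mul]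
    exact transl_zero U y
  | succ n ih =>
    rw [Nat.cast_succ, add_mul, one_mul]
    exact transl_add ih hc y

/-- If every length of the interval `c · (0, L)` (`c ≠ 0`) is a translation symmetry, then so is
every length `τ` with `|τ| < |c| L`: write `τ = c (L/2 + τ/(2c)) − c (L/2 − τ/(2c))`. [folklore] -/
theorem transl_of_abs_lt {U : EuclideanSpace ℝ (Fin 3) → EuclideanSpace ℝ (Fin 3)} {c L : ℝ}
    (hc : c ≠ 0)
    (H : ∀ σ ∈ Set.Ioo (0 : ℝ) L, ∀ y, U (y + (c * σ) • EuclideanSpace.single 2 (1 : ℝ)) = U y)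
    {τ : ℝ} (hτ : |τ| < |c| * L) (y : EuclideanSpace ℝ (Fin 3)) :
    U (y + τ • EuclideanSpace.single 2 (1 : ℝ)) = U y := by
  have hc' : 0 < |c| := abs_pos.2 hc
  have hσ : |τ / c| < L := by
    rw [abs_div, div_lt_iff₀ hc']
    linarith
  obtain ⟨h1, h2⟩ := abs_lt.1 hσ
  have e : τ = c * (L / 2 + τ / c / 2) + -(c * (L / 2 - τ / c / 2)) := by
    have hcc : c * (τ / c) = τ := mul_div_cancel₀ τ hc
    linear_combination -hcc
  rw [e]
  exact transl_add (H _ ⟨by linarith, by linarith⟩)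
    (transl_neg (H _ ⟨by linarith, by linarith⟩)) y

/-- If every length of an interval `c · (0, L)` (`c ≠ 0`, `L > 0`) is a translation symmetry, then
every length is (Archimedes: `τ = n · (τ/n)` with `|τ/n| < |c| L`). [folklore] -/
theorem transl_all {U : EuclideanSpace ℝ (Fin 3) → EuclideanSpace ℝ (Fin 3)} {c L : ℝ}
    (hc : c ≠ 0) (hL : 0 < L)
    (H : ∀ σ ∈ Set.Ioo (0 : ℝ) L, ∀ y, U (y + (c * σ) • EuclideanSpace.single 2 (1 : ℝ)) = U y)
    (τ : ℝ) (y : EuclideanSpace ℝ (Fin 3)) : U (y + τ • EuclideanSpace.single 2 (1 : ℝ)) = U y := by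
  have hδ : 0 < |c| * L := mul_pos (abs_pos.2 hc) hL
  obtain ⟨n, hn⟩ := exists_nat_gt (|τ| / (|c| * L))
  have hn0 : (0 : ℝ) < n := lt_of_le_of_lt (div_nonneg (abs_nonneg τ) hδ.le) hn
  rw [div_lt_iff₀ hδ] at hn
  have hsmall : |τ / n| < |c| * L := by
    rw [abs_div, Nat.abs_cast, div_lt_iff₀ hn0]
    linarith
  have key := transl_nat_mul (transl_of_abs_lt hc H hsmall) n y
  rwa [mul_div_cancel₀ τ hn0.ne'] at key

/-! ### Screw symmetries -/

/-- Conjugating a screw-symmetric field by a rotation `R_θ` about the axis gives a screw-symmetric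
field with the same angle and pitch (rotations about the axis commute and fix `e₃`). [folklore] -/
theorem screw_conj {U : EuclideanSpace ℝ (Fin 3) → EuclideanSpace ℝ (Fin 3)} {ψ h : ℝ}
    (hU : ∀ y, U (rotZ ψ y + h • EuclideanSpace.single 2 (1 : ℝ)) = rotZ ψ (U y)) (θ : ℝ)
    (y : EuclideanSpace ℝ (Fin 3)) :
    rotZ θ (U (rotZ (-θ) (rotZ ψ y + h • EuclideanSpace.single 2 (1 : ℝ)))) =
      rotZ ψ (rotZ θ (U (rotZ (-θ) y))) := by
  rw [rotZ_add_smul_e, rotZ_comm (-θ) ψ, hU, rotZ_comm θ ψ]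

/-- Two screw symmetries with the same angle `ψ` and pitches `h₁`, `h₂` give the translation
symmetry by `(h₁ − h₂) e₃`. [folklore] -/
theorem transl_of_two_screws {V : EuclideanSpace ℝ (Fin 3) → EuclideanSpace ℝ (Fin 3)}
    {ψ h₁ h₂ : ℝ}
    (H₁ : ∀ y, V (rotZ ψ y + h₁ • EuclideanSpace.single 2 (1 : ℝ)) = rotZ ψ (V y))
    (H₂ : ∀ y, V (rotZ ψ y + h₂ • EuclideanSpace.single 2 (1 : ℝ)) = rotZ ψ (V y))
    (w : EuclideanSpace ℝ (Fin 3)) :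
    V (w + (h₁ - h₂) • EuclideanSpace.single 2 (1 : ℝ)) = V w := by
  have key := H₁ (rotZ (-ψ) (w - h₂ • EuclideanSpace.single 2 (1 : ℝ)))
  rw [← H₂ (rotZ (-ψ) (w - h₂ • EuclideanSpace.single 2 (1 : ℝ))), rotZ_rotZ_neg,
    sub_add_cancel] at key
  have e : w + (h₁ - h₂) • EuclideanSpace.single 2 (1 : ℝ) =
      w - h₂ • EuclideanSpace.single 2 (1 : ℝ) + h₁ • EuclideanSpace.single 2 (1 : ℝ) := by
    rw [sub_smul]
    abel
  rw [e]
  exact key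

/-- A translation symmetry of the conjugate field `R_θ ∘ U ∘ R_{−θ}` along the axis is a
translation symmetry of `U` (the rotations are linear and fix `e₃`). [folklore] -/
theorem transl_of_conj {U : EuclideanSpace ℝ (Fin 3) → EuclideanSpace ℝ (Fin 3)} {θ c : ℝ}
    (H : ∀ w, rotZ θ (U (rotZ (-θ) (w + c • EuclideanSpace.single 2 (1 : ℝ)))) =
      rotZ θ (U (rotZ (-θ) w)))
    (y : EuclideanSpace ℝ (Fin 3)) : U (y + c • EuclideanSpace.single 2 (1 : ℝ)) = U y := by
  have key := congrArg (rotZ (-θ)) (H (rotZ θ y))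
  simp only [rotZ_neg_rotZ, rotZ_add_smul_e] at key
  exact key

/-- **Cancelling the self-similar factor.** If
`λ Φ(λ x) = R_ψ (λ Φ(λ R_{−ψ}(x − h e₃)))` for all `x` (`λ ≠ 0`, `Φ = R_θ ∘ U ∘ R_{−θ}`), then
`Φ` is screw-symmetric with angle `ψ` and pitch `λ h`: evaluate at `x = λ⁻¹ (R_ψ w + λ h e₃)`.
[folklore] -/
theorem screw_of_coincide_aux {U : EuclideanSpace ℝ (Fin 3) → EuclideanSpace ℝ (Fin 3)}
    {ψ h lam θ : ℝ} (hlam : lam ≠ 0)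
    (H : ∀ x : EuclideanSpace ℝ (Fin 3), lam • rotZ θ (U (rotZ (-θ) (lam • x))) =
      rotZ ψ (lam • rotZ θ (U (rotZ (-θ)
        (lam • rotZ (-ψ) (x - h • EuclideanSpace.single 2 (1 : ℝ)))))))
    (w : EuclideanSpace ℝ (Fin 3)) :
    rotZ θ (U (rotZ (-θ) (rotZ ψ w + (lam * h) • EuclideanSpace.single 2 (1 : ℝ)))) =
      rotZ ψ (rotZ θ (U (rotZ (-θ) w))) := by
  have key := H (lam⁻¹ • (rotZ ψ w + (lam * h) • EuclideanSpace.single 2 (1 : ℝ)))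
  rw [smul_inv_smul₀ hlam, rotZ_smul_vec ψ lam, ← rotZ_smul_vec (-ψ) lam, smul_sub,
    smul_inv_smul₀ hlam, smul_smul, add_sub_cancel_right, rotZ_neg_rotZ] at key
  exact smul_right_injective _ hlam key

/-- **The key computation.** If the rotated self-similar ansatz field of `U` coincides for
`t ∈ (−1, −1/2)` with its screw-conjugate (angle `ψ`, pitch `h`), then at each such time the
rotated profile `Φ = R_θ ∘ U ∘ R_{−θ}` (`θ = α s`, `s = −log(−t)`) is screw-symmetric with angle
`ψ` and the RESCALED pitch `λ h`, `λ = (−t)^{−1/2}`. [folklore] -/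
theorem screw_of_coincide {α ψ h : ℝ} {U : EuclideanSpace ℝ (Fin 3) → EuclideanSpace ℝ (Fin 3)}
    (H : ∀ t ∈ Set.Ioo (-1 : ℝ) (-(1 / 2)), ∀ x : EuclideanSpace ℝ (Fin 3),
      pvAnsatz α (fun y _ => U y) t x =
        rotZ ψ (pvAnsatz α (fun y _ => U y) t
          (rotZ (-ψ) (x - h • EuclideanSpace.single 2 (1 : ℝ)))))
    {t : ℝ} (ht : t ∈ Set.Ioo (-1 : ℝ) (-(1 / 2))) (w : EuclideanSpace ℝ (Fin 3)) :
    rotZ (α * -Real.log (-t)) (U (rotZ (-(α * -Real.log (-t)))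
        (rotZ ψ w + ((Real.sqrt (-t))⁻¹ * h) • EuclideanSpace.single 2 (1 : ℝ)))) =
      rotZ ψ (rotZ (α * -Real.log (-t)) (U (rotZ (-(α * -Real.log (-t))) w))) := by
  have hlam : (Real.sqrt (-t))⁻¹ ≠ 0 :=
    inv_ne_zero (Real.sqrt_pos.2 (by linarith [ht.2])).ne'
  have H' := H t ht
  simp only [pvAnsatz] at H'
  exact screw_of_coincide_aux hlam H' w

/-- At each time `t ∈ (−1, −1/2)` of coincidence, the screw-symmetric profile `U` (pitch `h`) is
invariant under the axial translation by `(h − λ h) e₃`, `λ = (−t)^{−1/2}`. [folklore] -/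
theorem transl_of_coincide {α ψ h : ℝ} {U : EuclideanSpace ℝ (Fin 3) → EuclideanSpace ℝ (Fin 3)}
    (hU : ∀ y, U (rotZ ψ y + h • EuclideanSpace.single 2 (1 : ℝ)) = rotZ ψ (U y))
    (H : ∀ t ∈ Set.Ioo (-1 : ℝ) (-(1 / 2)), ∀ x : EuclideanSpace ℝ (Fin 3),
      pvAnsatz α (fun y _ => U y) t x =
        rotZ ψ (pvAnsatz α (fun y _ => U y) t
          (rotZ (-ψ) (x - h • EuclideanSpace.single 2 (1 : ℝ)))))
    {t : ℝ} (ht : t ∈ Set.Ioo (-1 : ℝ) (-(1 / 2))) (y : EuclideanSpace ℝ (Fin 3)) :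
    U (y + (h - (Real.sqrt (-t))⁻¹ * h) • EuclideanSpace.single 2 (1 : ℝ)) = U y :=
  transl_of_conj (θ := α * -Real.log (-t))
    (transl_of_two_screws
      (V := fun z => rotZ (α * -Real.log (-t)) (U (rotZ (-(α * -Real.log (-t))) z)))
      (screw_conj hU _) (screw_of_coincide H ht)) y

/-- Every length of the interval `(−h) · (0, √2 − 1)` is a translation symmetry of `U`: for
`σ ∈ (0, √2 − 1)` the time `t = −(1 + σ)^{−2}` lies in `(−1, −1/2)` and has `(−t)^{−1/2} = 1 + σ`,
so `h − λ h = (−h) σ`. [folklore] -/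
theorem transl_interval {α ψ h : ℝ} {U : EuclideanSpace ℝ (Fin 3) → EuclideanSpace ℝ (Fin 3)}
    (hU : ∀ y, U (rotZ ψ y + h • EuclideanSpace.single 2 (1 : ℝ)) = rotZ ψ (U y))
    (H : ∀ t ∈ Set.Ioo (-1 : ℝ) (-(1 / 2)), ∀ x : EuclideanSpace ℝ (Fin 3),
      pvAnsatz α (fun y _ => U y) t x =
        rotZ ψ (pvAnsatz α (fun y _ => U y) t
          (rotZ (-ψ) (x - h • EuclideanSpace.single 2 (1 : ℝ)))))
    (σ : ℝ) (hσ : σ ∈ Set.Ioo (0 : ℝ) (Real.sqrt 2 - 1)) (y : EuclideanSpace ℝ (Fin 3)) :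
    U (y + (-h * σ) • EuclideanSpace.single 2 (1 : ℝ)) = U y := by
  have hl0 : 0 < 1 + σ := by linarith [hσ.1]
  have hi0 : 0 < (1 + σ)⁻¹ := inv_pos.2 hl0
  have ht : -((1 + σ)⁻¹ ^ 2) ∈ Set.Ioo (-1 : ℝ) (-(1 / 2)) := by
    have h1 : (1 + σ)⁻¹ ^ 2 < 1 :=
      pow_lt_one₀ hi0.le (inv_lt_one_of_one_lt₀ (by linarith [hσ.1])) two_ne_zero
    have hl2 : (1 + σ) ^ 2 < 2 := by
      have hlt : 1 + σ < Real.sqrt 2 := by linarith [hσ.2]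
      calc (1 + σ) ^ 2 < (Real.sqrt 2) ^ 2 := by gcongr
        _ = 2 := Real.sq_sqrt (by norm_num)
    have h2 : 1 / 2 < (1 + σ)⁻¹ ^ 2 := by
      rw [inv_pow, one_div, lt_inv_comm₀ (by norm_num) (by positivity), inv_inv]
      exact hl2
    constructor <;> linarith
  have key := transl_of_coincide hU H ht y
  rw [neg_neg, Real.sqrt_sq hi0.le, inv_inv] at key
  have e : -h * σ = h - (1 + σ) * h := by ring
  rw [e]
  exact key

end RssStratumScrew

/-- **Screw-symmetric profile + coincidence with the screw-conjugate ⇒ axially translation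
invariant.** If a profile `U` is screw-symmetric about the axis with angle `ψ` and pitch `h ≠ 0`,
`U (R_ψ y + h e₃) = R_ψ (U y)`, and its Pineau–Vicol rotated self-similar ansatz field
`pvAnsatz α U` ((1.7): `(−t)^{−1/2} R(αs) U(R(−αs) x/√(−t))`, `s = −log(−t)`) coincides for
`t ∈ (−1, −1/2)` with its screw-conjugate `x ↦ R_ψ u(R_{−ψ}(x − h e₃), t)`, then `U` is invariant
under every translation along the axis, `U (y + τ e₃) = U y`: at each such time the rescaled pitch
`λ h` (`λ = (−t)^{−1/2} ∈ (1, √2)`) is also a pitch of the rotated profile, so `(1 − λ) h` is a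
translation symmetry; these fill an interval, and the translation symmetries form a subgroup of
`ℝ`, which is all of `ℝ` once it contains a nontrivial interval. [folklore] -/
theorem rssStratum_transl_of_screw :
    ∀ (α ψ h : ℝ) (U : EuclideanSpace ℝ (Fin 3) → EuclideanSpace ℝ (Fin 3)), h ≠ 0 →
      (∀ y : EuclideanSpace ℝ (Fin 3),
        U (Literature.Analysis.FluidPDE.rotZ ψ y + h • EuclideanSpace.single 2 (1 : ℝ)) =
          Literature.Analysis.FluidPDE.rotZ ψ (U y)) →
      (∀ t ∈ Set.Ioo (-1 : ℝ) (-(1 / 2)), ∀ x : EuclideanSpace ℝ (Fin 3),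
        Literature.Analysis.FluidPDE.pvAnsatz α (fun y _ => U y) t x =
          Literature.Analysis.FluidPDE.rotZ ψ
            (Literature.Analysis.FluidPDE.pvAnsatz α (fun y _ => U y) t
              (Literature.Analysis.FluidPDE.rotZ (-ψ)
                (x - h • EuclideanSpace.single 2 (1 : ℝ))))) →
      ∀ (τ : ℝ) (y : EuclideanSpace ℝ (Fin 3)),
        U (y + τ • EuclideanSpace.single 2 (1 : ℝ)) = U y := by
  intro α ψ h U hh hU H τ y
  exact RssStratumScrew.transl_all (neg_ne_zero.2 hh) (sub_pos.2 Real.one_lt_sqrt_two)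
    (RssStratumScrew.transl_interval hU H) τ y

end Summit.NavierStokesRegularity.NavierStokesRegularity.Theorems

end
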